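import Mathlib
import HarnessLib
import Summits.HubbardSuperconductivity.HubbardSuperconductivity.Theorems.KLProgrammeKLRegimeTwoVolumeLipDiffSups

/-!
# Route `KLProgramme` — crux K3 ENGINE (stmt-HubbardSuperconductivity-20437 `KLRegimeEngineV17F2`), stub (e) proof-input «(e)-D-ROWS»: THE TWO-VOLUME DIFFERENCES OF THE
# LIPSCHITZ TOWER WITH EACH VOLUME IN ITS OWN FRAME (definitions; seat hubbard-kl-k3c4-p1 g25, VL lane; `--supports` 20437; memo DROWS-SCOPE-g25.md §13.16 option (A))

`…TwoVolumeLipDiffDefs` (g23) defines the two-volume differences `klLipInputDiff / klLipBornDiff L b M β U μ K d k` and their deep-pin sizes at ONE common frame `K` on both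
volumes.  The VL package consumed by row (e) (`EngineV8.A24a1G14.stub_twoLeg_step_of_dualRows`) compares the two volumes EACH IN ITS OWN FLOW FRAME
(`klFlowFrameU L₁ …` vs `klFlowFrameU L₂ …`), with own-frame histories as antecedents (located design point #8 «FRAMES», memo §13.16; route A's «scheme F own-frame
organisation»).  This file is the two-frame keying of the same objects — the coarse objects at `K₁`, the fine objects at `K₂`:

* **`klLipInputDiff₂ L b M β U μ K₁ K₂ d k := klLipInput (bL) … K₂ d k − klGlue (klLipInput L … K₁ d k)`**, **`klLipBornDiff₂ …`** likewise; at `K₁ = K₂` they ARE the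
  common-frame differences (`klLipInputDiff₂_self`, `klLipBornDiff₂_self`, `rfl`); `klLipInput_fine_eq₂`; parity / constant-part rows;
* **`klLipInputDiffSup₂ … K₁ K₂ d k m R`**, **`klLipBornDiffSup₂ …`** — the unweighted `R`-deep-pin sizes (same `⨆` construction over `klDeepPins L R`), with the
  `le_sup` / nonnegativity / antitonicity / `le_of_forall` / `of_near` / `sup_zero` rows, `…Sup₂_self`, and the crude cap `klLipBornDiffSup₂_le_crude`.
So every generic file of the tower keyed on `(difference object, fine-frame doors, glued coarse data)` re-keys by substitution.
Definitions with bodies and `rfl`/order rows only; nothing about the model is asserted; nothing asserts the (D) rows, stub (e), VL, K3 or superconductivity.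
References: BGM 2006 §2.8, §3 (3.2)–(3.8) [cite: BenfattoGiulianiMastropietro2006].
-/

noncomputable section

namespace Summit.HubbardSuperconductivity.HubbardSuperconductivity.Theorems.TwoVolumeLip

set_option linter.dupNamespace false -- summit = problem name (single-conjunct summit), D-0017

open Finset Literature.MathematicalPhysics.QuantumLattice GrassmannAlgebra Literature.Probability.LatticeModels
open Literature.MathematicalPhysics.QuantumLattice.FermiRG
open Summit.HubbardSuperconductivity.HubbardSuperconductivity.Theorems.KLRegimeSplit
open Summit.HubbardSuperconductivity.HubbardSuperconductivity.Theorems.KLProgrammeLegKernels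
open Summit.HubbardSuperconductivity.HubbardSuperconductivity.Theorems.DispersionFlow
open Summit.HubbardSuperconductivity.HubbardSuperconductivity.Theorems.EngineV8
open Summit.HubbardSuperconductivity.HubbardSuperconductivity.Theorems.TwoVolumeSource
open Summit.HubbardSuperconductivity.HubbardSuperconductivity.Theorems.TwoVolumeDefect

/-! ## §1 The two-volume differences with own frames -/

section Differences

variable (L b M : ℕ) [NeZero L] [NeZero (b * L)]

/-- **`klLipInputDiff₂ L b M β U μ K₁ K₂ d k`** — the MEASURED two-volume difference of block `k`, the coarse volume `L` in frame `K₁`, the fine volume `bL` in frame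
`K₂`: `klLipInput (bL) … K₂ d k − klGlue (klLipInput L … K₁ d k)`. -/
def klLipInputDiff₂ (β U μ : ℝ) (K₁ K₂ : TrigPolyC4v) (d k : ℕ) :
    GrassmannAlgebra ℂ (SpaceTimeIdx (b * L) M × SectorLeg (sectorCount (d * k - 1))) :=
  klLipInput (b * L) M β U μ K₂ d k - klGlue L b M (sectorCount (d * k - 1)) (klLipInput L M β U μ K₁ d k)

/-- **`klLipBornDiff₂ L b M β U μ K₁ K₂ d k`** — the BORN two-volume difference of block `k` with own frames:
`klLipBorn (bL) … K₂ d k − klGlue (klLipBorn L … K₁ d k)`. -/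
def klLipBornDiff₂ (β U μ : ℝ) (K₁ K₂ : TrigPolyC4v) (d k : ℕ) :
    GrassmannAlgebra ℂ (SpaceTimeIdx (b * L) M × SectorLeg (sectorCount (d * k))) :=
  klLipBorn (b * L) M β U μ K₂ d k - klGlue L b M (sectorCount (d * k)) (klLipBorn L M β U μ K₁ d k)

variable {L b M}

/-- Unfolding `klLipInputDiff₂`. -/
theorem klLipInputDiff₂_def (β U μ : ℝ) (K₁ K₂ : TrigPolyC4v) (d k : ℕ) :
    klLipInputDiff₂ L b M β U μ K₁ K₂ d k =
      klLipInput (b * L) M β U μ K₂ d k - klGlue L b M (sectorCount (d * k - 1)) (klLipInput L M β U μ K₁ d k) := rfl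

/-- Unfolding `klLipBornDiff₂`. -/
theorem klLipBornDiff₂_def (β U μ : ℝ) (K₁ K₂ : TrigPolyC4v) (d k : ℕ) :
    klLipBornDiff₂ L b M β U μ K₁ K₂ d k =
      klLipBorn (b * L) M β U μ K₂ d k - klGlue L b M (sectorCount (d * k)) (klLipBorn L M β U μ K₁ d k) := rfl

/-- At a common frame the own-frame measured difference IS `klLipInputDiff`. -/
theorem klLipInputDiff₂_self (β U μ : ℝ) (K : TrigPolyC4v) (d k : ℕ) :
    klLipInputDiff₂ L b M β U μ K K d k = klLipInputDiff L b M β U μ K d k := rfl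

/-- At a common frame the own-frame born difference IS `klLipBornDiff`. -/
theorem klLipBornDiff₂_self (β U μ : ℝ) (K : TrigPolyC4v) (d k : ℕ) :
    klLipBornDiff₂ L b M β U μ K K d k = klLipBornDiff L b M β U μ K d k := rfl

/-- `fine input (own frame) = glued coarse input (own frame) + measured difference`. -/
theorem klLipInput_fine_eq₂ (β U μ : ℝ) (K₁ K₂ : TrigPolyC4v) (d k : ℕ) :
    klLipInput (b * L) M β U μ K₂ d k =
      klGlue L b M (sectorCount (d * k - 1)) (klLipInput L M β U μ K₁ d k) + klLipInputDiff₂ L b M β U μ K₁ K₂ d k := by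
  rw [klLipInputDiff₂, add_sub_cancel]

/-- `fine born (own frame) = glued coarse born (own frame) + born difference`. -/
theorem klLipBorn_fine_eq₂ (β U μ : ℝ) (K₁ K₂ : TrigPolyC4v) (d k : ℕ) :
    klLipBorn (b * L) M β U μ K₂ d k =
      klGlue L b M (sectorCount (d * k)) (klLipBorn L M β U μ K₁ d k) + klLipBornDiff₂ L b M β U μ K₁ K₂ d k := by
  rw [klLipBornDiff₂, add_sub_cancel]

/-- The own-frame measured difference is even when both inputs are. -/
theorem klLipInputDiff₂_mem_evenOdd_zero {β U μ : ℝ} {K₁ K₂ : TrigPolyC4v} {d k : ℕ}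
    (hf : klTowerInput (b * L) M β U μ K₂ d k ∈ evenOdd ℂ 0) (hc : klTowerInput L M β U μ K₁ d k ∈ evenOdd ℂ 0) :
    klLipInputDiff₂ L b M β U μ K₁ K₂ d k ∈ evenOdd ℂ 0 :=
  sub_mem (klLipInput_mem_evenOdd_zero hf) (klGlue_mem_evenOdd_zero (klLipInput_mem_evenOdd_zero hc))

/-- The own-frame born difference is even when both increments are. -/
theorem klLipBornDiff₂_mem_evenOdd_zero {β U μ : ℝ} {K₁ K₂ : TrigPolyC4v} {d k : ℕ}
    (hf : klTowerIncr (b * L) M β U μ K₂ d k ∈ evenOdd ℂ 0) (hc : klTowerIncr L M β U μ K₁ d k ∈ evenOdd ℂ 0) :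
    klLipBornDiff₂ L b M β U μ K₁ K₂ d k ∈ evenOdd ℂ 0 :=
  sub_mem (klLipBorn_mem_evenOdd_zero hf) (klGlue_mem_evenOdd_zero (klLipBorn_mem_evenOdd_zero hc))

/-- The own-frame measured difference has no constant part when the inputs have none. -/
theorem constPart_klLipInputDiff₂ {β U μ : ℝ} {K₁ K₂ : TrigPolyC4v} {d k : ℕ}
    (hf : constPart ℂ (klTowerInput (b * L) M β U μ K₂ d k) = 0) (hc : constPart ℂ (klTowerInput L M β U μ K₁ d k) = 0) :
    constPart ℂ (klLipInputDiff₂ L b M β U μ K₁ K₂ d k) = 0 := by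
  rw [klLipInputDiff₂, map_sub, constPart_klLipInput, hf, constPart_klGlue (by rw [constPart_klLipInput, hc]), sub_zero]

/-- The own-frame born difference has no constant part when the increments have none. -/
theorem constPart_klLipBornDiff₂ {β U μ : ℝ} {K₁ K₂ : TrigPolyC4v} {d k : ℕ}
    (hf : constPart ℂ (klTowerIncr (b * L) M β U μ K₂ d k) = 0) (hc : constPart ℂ (klTowerIncr L M β U μ K₁ d k) = 0) :
    constPart ℂ (klLipBornDiff₂ L b M β U μ K₁ K₂ d k) = 0 := by
  rw [klLipBornDiff₂, map_sub, constPart_klLipBorn, hf, constPart_klGlue (by rw [constPart_klLipBorn, hc]), sub_zero]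

end Differences

/-! ## §2 The unweighted deep-pin sizes with own frames -/

section DeepData

variable (L b M : ℕ) [NeZero L] [NeZero (b * L)]

/-- **`klLipInputDiffSup₂ L b M β U μ K₁ K₂ d k m R`** — the unweighted `R`-deep-pin size of the own-frame measured difference in degree `m`: the supremum over slots
`q` and `R`-deep fine pins `w` of `Σ_{X : X_q = w} ‖kernel (klLipInputDiff₂ …) m X‖` (`0` on an empty index). -/
def klLipInputDiffSup₂ (β U μ : ℝ) (K₁ K₂ : TrigPolyC4v) (d k m R : ℕ) : ℝ :=
  ⨆ qw : Fin m × {w : SpaceTimeIdx (b * L) M × SectorLeg (sectorCount (d * k - 1)) // w ∈ klDeepPins L R},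
    ∑ X ∈ univ.filter (fun X : Fin m → SpaceTimeIdx (b * L) M × SectorLeg (sectorCount (d * k - 1)) => X qw.1 = qw.2.1),
      ‖kernel ℂ (klLipInputDiff₂ L b M β U μ K₁ K₂ d k) m X‖

/-- **`klLipBornDiffSup₂ L b M β U μ K₁ K₂ d k m R`** — the unweighted `R`-deep-pin size of the own-frame born difference in degree `m`. -/
def klLipBornDiffSup₂ (β U μ : ℝ) (K₁ K₂ : TrigPolyC4v) (d k m R : ℕ) : ℝ :=
  ⨆ qw : Fin m × {w : SpaceTimeIdx (b * L) M × SectorLeg (sectorCount (d * k)) // w ∈ klDeepPins L R},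
    ∑ X ∈ univ.filter (fun X : Fin m → SpaceTimeIdx (b * L) M × SectorLeg (sectorCount (d * k)) => X qw.1 = qw.2.1),
      ‖kernel ℂ (klLipBornDiff₂ L b M β U μ K₁ K₂ d k) m X‖

variable {L b M}

/-- At a common frame the own-frame measured size IS `klLipInputDiffSup`. -/
theorem klLipInputDiffSup₂_self (β U μ : ℝ) (K : TrigPolyC4v) (d k m R : ℕ) :
    klLipInputDiffSup₂ L b M β U μ K K d k m R = klLipInputDiffSup L b M β U μ K d k m R := rfl

/-- At a common frame the own-frame born size IS `klLipBornDiffSup`. -/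
theorem klLipBornDiffSup₂_self (β U μ : ℝ) (K : TrigPolyC4v) (d k m R : ℕ) :
    klLipBornDiffSup₂ L b M β U μ K K d k m R = klLipBornDiffSup L b M β U μ K d k m R := rfl

/-- Every pinned sum of the own-frame measured difference at an `R`-deep pin is at most the deep-pin size. -/
theorem sum_pinned_norm_kernel_inputDiff₂_le_sup (β U μ : ℝ) (K₁ K₂ : TrigPolyC4v) (d k m R : ℕ) (q : Fin m)
    {w : SpaceTimeIdx (b * L) M × SectorLeg (sectorCount (d * k - 1))} (hw : w ∈ klDeepPins L R) :
    ∑ X ∈ univ.filter (fun X : Fin m → SpaceTimeIdx (b * L) M × SectorLeg (sectorCount (d * k - 1)) => X q = w),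
        ‖kernel ℂ (klLipInputDiff₂ L b M β U μ K₁ K₂ d k) m X‖ ≤ klLipInputDiffSup₂ L b M β U μ K₁ K₂ d k m R :=
  le_ciSup (f := fun qw : Fin m × {w : SpaceTimeIdx (b * L) M × SectorLeg (sectorCount (d * k - 1)) // w ∈ klDeepPins L R} =>
    ∑ X ∈ univ.filter (fun X : Fin m → SpaceTimeIdx (b * L) M × SectorLeg (sectorCount (d * k - 1)) => X qw.1 = qw.2.1),
      ‖kernel ℂ (klLipInputDiff₂ L b M β U μ K₁ K₂ d k) m X‖) (Set.finite_range _).bddAbove (q, ⟨w, hw⟩)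

/-- Every pinned sum of the own-frame born difference at an `R`-deep pin is at most the deep-pin size. -/
theorem sum_pinned_norm_kernel_bornDiff₂_le_sup (β U μ : ℝ) (K₁ K₂ : TrigPolyC4v) (d k m R : ℕ) (q : Fin m)
    {w : SpaceTimeIdx (b * L) M × SectorLeg (sectorCount (d * k))} (hw : w ∈ klDeepPins L R) :
    ∑ X ∈ univ.filter (fun X : Fin m → SpaceTimeIdx (b * L) M × SectorLeg (sectorCount (d * k)) => X q = w),
        ‖kernel ℂ (klLipBornDiff₂ L b M β U μ K₁ K₂ d k) m X‖ ≤ klLipBornDiffSup₂ L b M β U μ K₁ K₂ d k m R :=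
  le_ciSup (f := fun qw : Fin m × {w : SpaceTimeIdx (b * L) M × SectorLeg (sectorCount (d * k)) // w ∈ klDeepPins L R} =>
    ∑ X ∈ univ.filter (fun X : Fin m → SpaceTimeIdx (b * L) M × SectorLeg (sectorCount (d * k)) => X qw.1 = qw.2.1),
      ‖kernel ℂ (klLipBornDiff₂ L b M β U μ K₁ K₂ d k) m X‖) (Set.finite_range _).bddAbove (q, ⟨w, hw⟩)

/-- The own-frame measured size is nonnegative. -/
theorem klLipInputDiffSup₂_nonneg (β U μ : ℝ) (K₁ K₂ : TrigPolyC4v) (d k m R : ℕ) : 0 ≤ klLipInputDiffSup₂ L b M β U μ K₁ K₂ d k m R := by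
  unfold klLipInputDiffSup₂
  rcases isEmpty_or_nonempty (Fin m × {w : SpaceTimeIdx (b * L) M × SectorLeg (sectorCount (d * k - 1)) // w ∈ klDeepPins L R}) with h | h
  · rw [Real.iSup_of_isEmpty]
  · exact le_ciSup_of_le (Set.finite_range _).bddAbove (Classical.arbitrary _) (sum_nonneg fun _ _ => norm_nonneg _)

/-- The own-frame born size is nonnegative. -/
theorem klLipBornDiffSup₂_nonneg (β U μ : ℝ) (K₁ K₂ : TrigPolyC4v) (d k m R : ℕ) : 0 ≤ klLipBornDiffSup₂ L b M β U μ K₁ K₂ d k m R := by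
  unfold klLipBornDiffSup₂
  rcases isEmpty_or_nonempty (Fin m × {w : SpaceTimeIdx (b * L) M × SectorLeg (sectorCount (d * k)) // w ∈ klDeepPins L R}) with h | h
  · rw [Real.iSup_of_isEmpty]
  · exact le_ciSup_of_le (Set.finite_range _).bddAbove (Classical.arbitrary _) (sum_nonneg fun _ _ => norm_nonneg _)

/-- The own-frame measured size is at most any common nonnegative bound of the pinned sums at deep pins. -/
theorem klLipInputDiffSup₂_le_of_forall (β U μ : ℝ) (K₁ K₂ : TrigPolyC4v) (d k m R : ℕ) {B : ℝ} (hB : 0 ≤ B)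
    (h : ∀ (q : Fin m) (w : SpaceTimeIdx (b * L) M × SectorLeg (sectorCount (d * k - 1))), w ∈ klDeepPins L R →
      ∑ X ∈ univ.filter (fun X : Fin m → SpaceTimeIdx (b * L) M × SectorLeg (sectorCount (d * k - 1)) => X q = w),
        ‖kernel ℂ (klLipInputDiff₂ L b M β U μ K₁ K₂ d k) m X‖ ≤ B) :
    klLipInputDiffSup₂ L b M β U μ K₁ K₂ d k m R ≤ B := by
  unfold klLipInputDiffSup₂
  rcases isEmpty_or_nonempty (Fin m × {w : SpaceTimeIdx (b * L) M × SectorLeg (sectorCount (d * k - 1)) // w ∈ klDeepPins L R}) with h' | h'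
  · rw [Real.iSup_of_isEmpty]; exact hB
  · exact ciSup_le fun qw => h qw.1 qw.2.1 qw.2.2

/-- The own-frame born size is at most any common nonnegative bound of the pinned sums at deep pins. -/
theorem klLipBornDiffSup₂_le_of_forall (β U μ : ℝ) (K₁ K₂ : TrigPolyC4v) (d k m R : ℕ) {B : ℝ} (hB : 0 ≤ B)
    (h : ∀ (q : Fin m) (w : SpaceTimeIdx (b * L) M × SectorLeg (sectorCount (d * k))), w ∈ klDeepPins L R →
      ∑ X ∈ univ.filter (fun X : Fin m → SpaceTimeIdx (b * L) M × SectorLeg (sectorCount (d * k)) => X q = w),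
        ‖kernel ℂ (klLipBornDiff₂ L b M β U μ K₁ K₂ d k) m X‖ ≤ B) :
    klLipBornDiffSup₂ L b M β U μ K₁ K₂ d k m R ≤ B := by
  unfold klLipBornDiffSup₂
  rcases isEmpty_or_nonempty (Fin m × {w : SpaceTimeIdx (b * L) M × SectorLeg (sectorCount (d * k)) // w ∈ klDeepPins L R}) with h' | h'
  · rw [Real.iSup_of_isEmpty]; exact hB
  · exact ciSup_le fun qw => h qw.1 qw.2.1 qw.2.2

/-- Antitonicity in the depth (measured, own frames). -/
theorem klLipInputDiffSup₂_anti (β U μ : ℝ) (K₁ K₂ : TrigPolyC4v) (d k m : ℕ) {R R' : ℕ} (h : R ≤ R') :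
    klLipInputDiffSup₂ L b M β U μ K₁ K₂ d k m R' ≤ klLipInputDiffSup₂ L b M β U μ K₁ K₂ d k m R :=
  klLipInputDiffSup₂_le_of_forall β U μ K₁ K₂ d k m R' (klLipInputDiffSup₂_nonneg β U μ K₁ K₂ d k m R)
    fun q _ hw => sum_pinned_norm_kernel_inputDiff₂_le_sup β U μ K₁ K₂ d k m R q (klDeepPins_mono h hw)

/-- Antitonicity in the depth (born, own frames). -/
theorem klLipBornDiffSup₂_anti (β U μ : ℝ) (K₁ K₂ : TrigPolyC4v) (d k m : ℕ) {R R' : ℕ} (h : R ≤ R') :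
    klLipBornDiffSup₂ L b M β U μ K₁ K₂ d k m R' ≤ klLipBornDiffSup₂ L b M β U μ K₁ K₂ d k m R :=
  klLipBornDiffSup₂_le_of_forall β U μ K₁ K₂ d k m R' (klLipBornDiffSup₂_nonneg β U μ K₁ K₂ d k m R)
    fun q _ hw => sum_pinned_norm_kernel_bornDiff₂_le_sup β U μ K₁ K₂ d k m R q (klDeepPins_mono h hw)

/-- `hE` of the transfer doors (own frames): at a pin within `r` of a `(D + r)`-deep label, the pinned sum of the born difference is at most the size at depth `D`. -/
theorem sum_pinned_norm_kernel_bornDiff₂_le_sup_of_near (β U μ : ℝ) (K₁ K₂ : TrigPolyC4v) (d k : ℕ) {m : ℕ} (q : Fin m) {N₂ D r : ℕ}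
    {w' : SpaceTimeIdx (b * L) M × SectorLeg N₂} (hw : ∀ j, D + r ≤ (w'.1.2 j).val % L ∧ (w'.1.2 j).val % L + (D + r) < L)
    (y' : SpaceTimeIdx (b * L) M × SectorLeg (sectorCount (d * k))) (hy : Torus.tnorm (w'.1.2 - y'.1.2) ≤ r) :
    ∑ X ∈ univ.filter (fun X : Fin m → SpaceTimeIdx (b * L) M × SectorLeg (sectorCount (d * k)) => X q = y'),
        ‖kernel ℂ (klLipBornDiff₂ L b M β U μ K₁ K₂ d k) m X‖ ≤ klLipBornDiffSup₂ L b M β U μ K₁ K₂ d k m D :=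
  sum_pinned_norm_kernel_bornDiff₂_le_sup β U μ K₁ K₂ d k m D q (mem_klDeepPins_of_tnorm_le hw hy)

/-- `hND` of the transfer doors (own frames): every pinned sum of the born difference is at most the size at depth `0`. -/
theorem sum_pinned_norm_kernel_bornDiff₂_le_sup_zero (β U μ : ℝ) (K₁ K₂ : TrigPolyC4v) (d k : ℕ) {m : ℕ} (q : Fin m)
    (y' : SpaceTimeIdx (b * L) M × SectorLeg (sectorCount (d * k))) :
    ∑ X ∈ univ.filter (fun X : Fin m → SpaceTimeIdx (b * L) M × SectorLeg (sectorCount (d * k)) => X q = y'),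
        ‖kernel ℂ (klLipBornDiff₂ L b M β U μ K₁ K₂ d k) m X‖ ≤ klLipBornDiffSup₂ L b M β U μ K₁ K₂ d k m 0 :=
  sum_pinned_norm_kernel_bornDiff₂_le_sup β U μ K₁ K₂ d k m 0 q (mem_klDeepPins_zero L y')

/-- `hE`-type reading of the measured difference (own frames). -/
theorem sum_pinned_norm_kernel_inputDiff₂_le_sup_of_near (β U μ : ℝ) (K₁ K₂ : TrigPolyC4v) (d k : ℕ) {m : ℕ} (q : Fin m) {N₂ D r : ℕ}
    {w' : SpaceTimeIdx (b * L) M × SectorLeg N₂} (hw : ∀ j, D + r ≤ (w'.1.2 j).val % L ∧ (w'.1.2 j).val % L + (D + r) < L)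
    (y' : SpaceTimeIdx (b * L) M × SectorLeg (sectorCount (d * k - 1))) (hy : Torus.tnorm (w'.1.2 - y'.1.2) ≤ r) :
    ∑ X ∈ univ.filter (fun X : Fin m → SpaceTimeIdx (b * L) M × SectorLeg (sectorCount (d * k - 1)) => X q = y'),
        ‖kernel ℂ (klLipInputDiff₂ L b M β U μ K₁ K₂ d k) m X‖ ≤ klLipInputDiffSup₂ L b M β U μ K₁ K₂ d k m D :=
  sum_pinned_norm_kernel_inputDiff₂_le_sup β U μ K₁ K₂ d k m D q (mem_klDeepPins_of_tnorm_le hw hy)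

/-- `hND`-type reading of the measured difference (own frames). -/
theorem sum_pinned_norm_kernel_inputDiff₂_le_sup_zero (β U μ : ℝ) (K₁ K₂ : TrigPolyC4v) (d k : ℕ) {m : ℕ} (q : Fin m)
    (y' : SpaceTimeIdx (b * L) M × SectorLeg (sectorCount (d * k - 1))) :
    ∑ X ∈ univ.filter (fun X : Fin m → SpaceTimeIdx (b * L) M × SectorLeg (sectorCount (d * k - 1)) => X q = y'),
        ‖kernel ℂ (klLipInputDiff₂ L b M β U μ K₁ K₂ d k) m X‖ ≤ klLipInputDiffSup₂ L b M β U μ K₁ K₂ d k m 0 :=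
  sum_pinned_norm_kernel_inputDiff₂_le_sup β U μ K₁ K₂ d k m 0 q (mem_klDeepPins_zero L y')

/-- **Crude cap (own frames)**: the born size is at most the fine plus the coarse one-volume pinned sizes, any depth. -/
theorem klLipBornDiffSup₂_le_crude (β U μ : ℝ) (K₁ K₂ : TrigPolyC4v) (d k m R : ℕ) {N N' : ℝ} (hN0 : 0 ≤ N) (hN'0 : 0 ≤ N')
    (hN : ∀ (q : Fin m) (y : SpaceTimeIdx L M × SectorLeg (sectorCount (d * k))),
      ∑ Y ∈ univ.filter (fun Y : Fin m → SpaceTimeIdx L M × SectorLeg (sectorCount (d * k)) => Y q = y), ‖kernel ℂ (klLipBorn L M β U μ K₁ d k) m Y‖ ≤ N)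
    (hN' : ∀ (q : Fin m) (y' : SpaceTimeIdx (b * L) M × SectorLeg (sectorCount (d * k))),
      ∑ Y' ∈ univ.filter (fun Y' : Fin m → SpaceTimeIdx (b * L) M × SectorLeg (sectorCount (d * k)) => Y' q = y'),
        ‖kernel ℂ (klLipBorn (b * L) M β U μ K₂ d k) m Y'‖ ≤ N') :
    klLipBornDiffSup₂ L b M β U μ K₁ K₂ d k m R ≤ N' + N := by
  refine klLipBornDiffSup₂_le_of_forall β U μ K₁ K₂ d k m R (add_nonneg hN'0 hN0) fun q w _ => ?_
  rw [klLipBornDiff₂_def]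
  calc _ ≤ ∑ X ∈ univ.filter (fun X : Fin m → SpaceTimeIdx (b * L) M × SectorLeg (sectorCount (d * k)) => X q = w),
        (‖kernel ℂ (klLipBorn (b * L) M β U μ K₂ d k) m X‖ +
          ‖kernel ℂ (klGlue L b M (sectorCount (d * k)) (klLipBorn L M β U μ K₁ d k)) m X‖) :=
        sum_le_sum fun X _ => by rw [kernel_sub']; exact norm_sub_le _ _
    _ ≤ N' + N := by
        rw [sum_add_distrib, sum_pinned_norm_kernel_klGlue_eq (klLipBorn L M β U μ K₁ d k) q w]
        exact add_le_add (hN' q w) (hN q _)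

end DeepData

end Summit.HubbardSuperconductivity.HubbardSuperconductivity.Theorems.TwoVolumeLip

end
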